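import Literature.Computability.AlgebraicComplexity.CombinationLossProgramLevelThree
import HarnessLib

/-!
# The combination-loss laser program at level `ℓ* = 4` (eighth power of `CW_q`): typed statement
(Dupont–Eisenberger–Kozlovskii–Mehrabian–Ruiz–See–Zhou–Alman–Vassilevska Williams–Balog 2026, §2,
program (11) and Theorem 1 = Alman–Duan–Vassilevska Williams–Xu–Xu–Zhou 2025, §7)

Topic `Literature/Computability/AlgebraicComplexity`.  Companion of `CombinationLossProgramLevelTwo.lean`
and `CombinationLossProgramLevelThree.lean`, which TYPE program (11) of arXiv:2608.16884v1 §2 at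
`ℓ* = 2, 3`.  This file types the instance `ℓ* = 4` — the analysis of `CW_q^{⊗8}`, the program DEK+26
solve numerically at `q = 5` for their announced `ω < 2.371177` (§3–§4; point unreleased) — verbatim
from the note's §2 with `ℓ* = 4` substituted.  The tree (§2.1) has one more layer than at `ℓ* = 3`: root
children `G[s, r]` (`s ∈ S₄`, 153 shapes; LEAF if `s` is a zero-shape, level-4 POSITIVE NODE `T` if `s`
is positive), children `T[u, r′]` of a level-4 node (`u ∈ Split(s) ⊆ S₃`; LEAF if `u` is a zero-shape,
level-3 POSITIVE NODE `U` otherwise), and the level-2 leaves `U[v, r″]` (`v ∈ Split(u) ⊆ S₂`).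

DESIGN (definitional convenience, no change of content): the subtree below a level-4 node `T = G[s,r]`
in one child-region `r′` — the nodes `U = T[u,r′]` with their `A_U`, `α_U^{(r″)}` and level-2 leaves —
is EXACTLY the node layer of an `ℓ* = 3` point; `Point.view3 P r s r′` packages it as a
`CombinationLoss3.Point` (root fields unused) so that the level-3 clauses of §2.3 (eq. (2), and the rôle
factors (6)–(8) of `U`) are the `ℓ* = 3` file's `rootChildBeta` / `posTermAt` read on the view, reused
unchanged.  Masses, `E₃`, `E₂` and the sizes `M` are typed afresh (their weights run through the whole
tree).  Length-8 complete split vectors are pairs of length-4 ones, so the concatenation product of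
§2.3 is `β₁(L.1) · β₂(L.2)`.

Nothing is proved here: the definitions are the paper's, and Theorem 1 (case `ℓ* = 4`) is recorded as
the NAMED FACT `combinationLoss4_theorem1 : Prop` (statement only; its proof is §4–§6 of Alman et
al. 2025, not formalised).  Purpose: the typed interface for the exact rational `ℓ* = 4` points of the
ω-construction census, family (c) (`run/shared/lean/pub/pub-omega/`, schema `SCHEMA-c.md` v1; e.g.
the certified point `l4g7_W7TC_cert.json`, sha256 `f7d23034…1969`, `Ω = 2.371169262`, row R289).
HONEST FRAMING (census, verbatim): lottery ticket; floor = certified bounds/negative ranges.  Every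
bound obtained through this interface is CONDITIONAL on the named fact; the tree's unconditional
record remains `LeGall2014_cw4_omega_le : ω ≤ 2.37295`.

Dictionary (note §2 ↔ this file), beyond the `ℓ* = 2, 3` dictionaries: `S₄` ↔ `shapes4`; `Split(s)` ↔
`split4 s`; `{0,1,2}⁸` ↔ `Vec4 × Vec4`, `splitVecs8`, `C_{4,a}` ↔ `csplit4 a`; masses ↔ `mass4/3/2`;
β ↔ `leafBeta4`, `nodeBetaR`, `nodeBeta`, `childBeta`; eq. (5) ↔ `rootTerm*`, `EG`; eq. (8) ↔ `posTerm*`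
(level 4), `CombinationLoss3.posTermAt ∘ view3` (level 3); `E₄`, `E₃`, (9), (10), (11) ↔ `E4`, `E3`,
`E2`, `Mcoord`, `Feasible` (right-hand side `2^{4−1} log₂(q+2) = 8 log₂(q+2)`).  The transcription
agrees clause by clause with the census's evaluator of record (`closs.py`: `build_tree`,
`compute_masses`, `compute_betas`, `region_terms`, `evaluate` with `lev_sums[4]`, `lev_sums[3]`).

## References

* E. Dupont et al., arXiv:2608.16884v1 (2026), §2 (pp. 2–8), eq. (1)–(11), Thm. 1. [DupontEtAl2026]
* J. Alman, R. Duan, V. Vassilevska Williams, Y. Xu, Z. Xu, R. Zhou, *More asymmetry yields faster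
  matrix multiplication*, SODA 2025, arXiv:2404.16349, §7 (the optimisation problem; Table 1).
  [AlmanDuanVassilevskaWilliamsXuXuZhou2025]
-/

noncomputable section

open scoped BigOperators
open Finset Real

namespace Literature.Computability.AlgebraicComplexity

namespace CombinationLoss4

open CombinationLoss2
open CombinationLoss3 (shapes3 split3 sub3 splitVecs4 csplit3 ones4 vee4 Hmarg3)

/-! ## Shapes of level 4, split sets, complete split vectors of length 8 (note §2.1–§2.2 at `ℓ* = 4`) -/
/-- `S₄ = {(i, j, k) ∈ ℤ³_{≥0} : i + j + k = 2⁴ = 16}` (153 shapes), as the image of `(i, j) ↦ (i, j, 16 − i − j)`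
over `i + j ≤ 16`. [cite: DupontEtAl2026, §2.1] -/
def shapes4 : Finset Shape :=
  ((range 17 ×ˢ range 17).filter (fun p => p.1 + p.2 ≤ 16)).image (fun p => (p.1, p.2, 16 - p.1 - p.2))

/-- Positive level-4 shapes (105 of them). [cite: DupontEtAl2026, §2.1] -/
def posShapes4 : Finset Shape := shapes4.filter IsPos

/-- Zero-shapes of `S₄` (48 of them): the root's leaf children. [cite: DupontEtAl2026, §2.1] -/
def zeroShapes4 : Finset Shape := shapes4.filter (fun s => ¬ IsPos s)

/-- `Split(s) = {u ∈ S₃ : 0 ≤ u_W ≤ s_W for all W}` for a level-4 shape `s`. [cite: DupontEtAl2026, §2.1] -/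
def split4 (s : Shape) : Finset Shape :=
  shapes3.filter (fun u => u.1 ≤ s.1 ∧ u.2.1 ≤ s.2.1 ∧ u.2.2 ≤ s.2.2)

/-- Length-4 complete split vectors, the two halves of a length-8 one. [cite: DupontEtAl2026, §2.2] -/
abbrev Vec4 := ℕ × ℕ × ℕ × ℕ

/-- Level-4 complete split vectors `L = (L₁,…,L₈) ∈ {0,1,2}⁸` as pairs of halves (all `3⁸ = 6561`). [cite:
DupontEtAl2026, §2.2] -/
def splitVecs8 : Finset (Vec4 × Vec4) := splitVecs4 ×ˢ splitVecs4

/-- Sum of the entries of a length-4 split vector. [cite: DupontEtAl2026, §2.2] -/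
def sum4 (L : Vec4) : ℕ := L.1 + L.2.1 + L.2.2.1 + L.2.2.2

/-- `C_{4,a} = {L ∈ {0,1,2}⁸ : L₁ + ⋯ + L₈ = a}`. [cite: DupontEtAl2026, §2.2] -/
def csplit4 (a : ℕ) : Finset (Vec4 × Vec4) := splitVecs8.filter (fun L => sum4 L.1 + sum4 L.2 = a)

/-- Number of entries of a length-8 split vector equal to `1`. [cite: DupontEtAl2026, §2.3] -/
def ones8 (L : Vec4 × Vec4) : ℕ := ones4 L.1 + ones4 L.2

/-- `L ↦ 2⃗ − L` on length-8 split vectors (the map `β ↦ β^∨`). [cite: DupontEtAl2026, §2.3] -/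
def vee8 (L : Vec4 × Vec4) : Vec4 × Vec4 := (vee4 L.1, vee4 L.2)

/-! ## Free variables (note §2.2 at `ℓ* = 4`) and their domains -/
/-- A parameter point of program (11) at `ℓ* = 4`: root `A_G ∈ Δ([6])`, `α_G^{(r)} ∈ Δ(S₄)`; a zero-shape root
child's `β_{W₁} ∈ Δ(C_{4,s_{W₁}})`; a level-4 node `T = G[s,r]`'s `A_T`, `α_T^{(r′)} ∈ Δ(Split(s))`; a zero-shape
child `T[u,r′]`'s `β_{W₁} ∈ Δ(C_{3,u_{W₁}})`; a level-3 node `U = T[u,r′]`'s `A_U`, `α_U^{(r″)} ∈ Δ(Split(u))`; a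
leaf `U[v,r″]`'s `μ ∈ [0,1/2]` (positive `v`) or `β_{W₁} ∈ Δ(C_{2,v_{W₁}})` (zero-shape `v`).  Unused fields are
ignored. [cite: DupontEtAl2026, §2.2] -/
structure Point where
  /-- `A_G^{(r)}` -/ A : Fin 6 → ℝ
  /-- `α_G^{(r)}(s)`, `s ∈ S₄` -/ alpha : Fin 6 → Shape → ℝ
  /-- `β_{G[s,r], W₁}(L)` for zero-shapes `s ∈ S₄`, `L ∈ {0,1,2}⁸` -/ beta4 : Fin 6 → Shape → Vec4 × Vec4 → ℝ
  /-- `A_T^{(r′)}` of the level-4 node `T = G[s,r]` -/ AT : Fin 6 → Shape → Fin 6 → ℝ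
  /-- `α_T^{(r′)}(u)`, `u ∈ Split(s)` -/ alphaT : Fin 6 → Shape → Fin 6 → Shape → ℝ
  /-- `β_{T[u,r′], W₁}(L)` for zero-shapes `u ∈ Split(s)`, `L ∈ {0,1,2}⁴` -/ beta3 : Fin 6 → Shape → Fin 6 → Shape → Vec4 → ℝ
  /-- `A_U^{(r″)}` of the level-3 node `U = T[u,r′]` -/ AU : Fin 6 → Shape → Fin 6 → Shape → Fin 6 → ℝ
  /-- `α_U^{(r″)}(v)`, `v ∈ Split(u)` -/ alphaU : Fin 6 → Shape → Fin 6 → Shape → Fin 6 → Shape → ℝ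
  /-- `μ_{U[v,r″]}` for positive `v` -/ mu2 : Fin 6 → Shape → Fin 6 → Shape → Fin 6 → Shape → ℝ
  /-- `β_{U[v,r″], W₁}(L)` for zero-shapes `v`, `L ∈ {0,1,2}²` -/ beta2 : Fin 6 → Shape → Fin 6 → Shape → Fin 6 → Shape → (ℕ × ℕ) → ℝ

/-- The node layer below the level-4 node `T = G[s,r]` in child-region `r′` as (the node layer of) an `ℓ* = 3`
point: its positive node / zero-shape root child of shape `u` is `T[u,r′]`; the dummy first index and the root
fields are unused. [cite: DupontEtAl2026, §2.1–§2.2] -/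
def Point.view3 (P : Point) (r : Fin 6) (s : Shape) (r' : Fin 6) : CombinationLoss3.Point where
  A := fun _ => 0
  alpha := fun _ _ => 0
  beta3 := fun _ u L => P.beta3 r s r' u L
  AT := fun _ u r'' => P.AU r s r' u r''
  alphaT := fun _ u r'' v => P.alphaU r s r' u r'' v
  mu2 := fun _ u r'' v => P.mu2 r s r' u r'' v
  beta2 := fun _ u r'' v L => P.beta2 r s r' u r'' v L

/-- The domain constraints of §2.2 at `ℓ* = 4` ("all free variables lie in the domains stated"). [cite:
DupontEtAl2026, §2.2 and eq. (11)] -/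
structure Point.Valid (P : Point) : Prop where
  A_nonneg : ∀ r, 0 ≤ P.A r
  A_sum : ∑ r, P.A r = 1
  alpha_nonneg : ∀ r s, 0 ≤ P.alpha r s
  alpha_supp : ∀ r s, s ∉ shapes4 → P.alpha r s = 0
  alpha_sum : ∀ r, ∑ s ∈ shapes4, P.alpha r s = 1
  beta4_nonneg : ∀ r s L, 0 ≤ P.beta4 r s L
  beta4_supp : ∀ r s L, ¬ IsPos s → L ∉ csplit4 (coord s (firstNonzero s)) → P.beta4 r s L = 0
  beta4_sum : ∀ r s, s ∈ shapes4 → ¬ IsPos s →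
    ∑ L ∈ csplit4 (coord s (firstNonzero s)), P.beta4 r s L = 1
  AT_nonneg : ∀ r s r', 0 ≤ P.AT r s r'
  AT_sum : ∀ r s, s ∈ posShapes4 → ∑ r', P.AT r s r' = 1
  alphaT_nonneg : ∀ r s r' u, 0 ≤ P.alphaT r s r' u
  alphaT_supp : ∀ r s r' u, u ∉ split4 s → P.alphaT r s r' u = 0
  alphaT_sum : ∀ r s r', s ∈ posShapes4 → ∑ u ∈ split4 s, P.alphaT r s r' u = 1
  beta3_nonneg : ∀ r s r' u L, 0 ≤ P.beta3 r s r' u L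
  beta3_supp : ∀ r s r' u L, ¬ IsPos u → L ∉ csplit3 (coord u (firstNonzero u)) →
    P.beta3 r s r' u L = 0
  beta3_sum : ∀ r s r' u, s ∈ posShapes4 → u ∈ split4 s → ¬ IsPos u →
    ∑ L ∈ csplit3 (coord u (firstNonzero u)), P.beta3 r s r' u L = 1
  AU_nonneg : ∀ r s r' u r'', 0 ≤ P.AU r s r' u r''
  AU_sum : ∀ r s r' u, s ∈ posShapes4 → u ∈ split4 s → IsPos u → ∑ r'', P.AU r s r' u r'' = 1
  alphaU_nonneg : ∀ r s r' u r'' v, 0 ≤ P.alphaU r s r' u r'' v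
  alphaU_supp : ∀ r s r' u r'' v, v ∉ split3 u → P.alphaU r s r' u r'' v = 0
  alphaU_sum : ∀ r s r' u r'', s ∈ posShapes4 → u ∈ split4 s → IsPos u →
    ∑ v ∈ split3 u, P.alphaU r s r' u r'' v = 1
  mu2_mem : ∀ r s r' u r'' v, IsPos v → 0 ≤ P.mu2 r s r' u r'' v ∧ P.mu2 r s r' u r'' v ≤ 1 / 2
  beta2_nonneg : ∀ r s r' u r'' v L, 0 ≤ P.beta2 r s r' u r'' v L
  beta2_supp : ∀ r s r' u r'' v L, ¬ IsPos v → L ∉ csplit2 (coord v (firstNonzero v)) →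
    P.beta2 r s r' u r'' v L = 0
  beta2_sum : ∀ r s r' u r'' v, s ∈ posShapes4 → u ∈ split4 s → IsPos u → v ∈ split3 u →
    ¬ IsPos v → ∑ L ∈ csplit2 (coord v (firstNonzero v)), P.beta2 r s r' u r'' v L = 1

/-! ## Masses (note §2.3, "Masses") -/
/-- Mass of the root child `G[s,r]`: `m = A_G^{(r)} α_G^{(r)}(s)`. [cite: DupontEtAl2026, §2.3 (Masses)] -/
def mass4 (P : Point) (r : Fin 6) (s : Shape) : ℝ := P.A r * P.alpha r s

/-- Weight `α_T^{(r′)}(u) + α_T^{(r′)}(s − u)` of the child `T[u,r′]` of the level-4 node of shape `s`. [cite: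
DupontEtAl2026, §2.3 (Masses) and eqs. (6)–(7)] -/
def childW (P : Point) (r : Fin 6) (s : Shape) (r' : Fin 6) (u : Shape) : ℝ :=
  P.alphaT r s r' u + P.alphaT r s r' (sub3 s u)

/-- Mass of the child `T[u,r′]` of the level-4 node `T = G[s,r]`: `m_{T[u,r′]} = m_T · A_T^{(r′)} · (α_T^{(r′)}(u) +
α_T^{(r′)}(s − u))`. [cite: DupontEtAl2026, §2.3 (Masses)] -/
def mass3 (P : Point) (r : Fin 6) (s : Shape) (r' : Fin 6) (u : Shape) : ℝ :=
  mass4 P r s * P.AT r s r' * childW P r s r' u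

/-- Mass of the leaf `U[v,r″]` of the level-3 node `U = T[u,r′]`: `m_U · A_U^{(r″)} · (α_U^{(r″)}(v) + α_U^{(r″)}(u
− v))`. [cite: DupontEtAl2026, §2.3 (Masses)] -/
def mass2 (P : Point) (r : Fin 6) (s : Shape) (r' : Fin 6) (u : Shape) (r'' : Fin 6) (v : Shape) : ℝ :=
  mass3 P r s r' u * P.AU r s r' u r'' * (P.alphaU r s r' u r'' v + P.alphaU r s r' u r'' (sub3 u v))

/-! ## Complete split distributions (note §2.3, eq. (2) and the recursive clause for positive nodes) -/
/-- `β_{T[u,r′], c}` (length 4) of ANY child of the level-4 node `T = G[s,r]`: the node `U = T[u,r′]`'s `Σ_{r″}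
A_U^{(r″)} β^{(r″)}_{U,c}` for positive `u`, the leaf's `δ_{0⃗}` / `β_{W₁}` / `β^∨` for a zero-shape `u` — the `ℓ* =
3` clause `rootChildBeta` read on the view. [cite: DupontEtAl2026, §2.3 eq. (2)] -/
def childBeta (P : Point) (r : Fin 6) (s : Shape) (r' : Fin 6) (u : Shape) (c : Fin 3) (L : Vec4) : ℝ :=
  CombinationLoss3.rootChildBeta (P.view3 r s r') 0 u c L

/-- `β_{G[s,r], c}` (length 8) of a zero-shape root child: `δ_{0⃗}` on `W₀`, the free `β_{W₁}` on `W₁`, `β_{W₁}^∨`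
on the remaining coordinate. [cite: DupontEtAl2026, §2.3 eq. (2)] -/
def leafBeta4 (P : Point) (r : Fin 6) (s : Shape) (c : Fin 3) (L : Vec4 × Vec4) : ℝ :=
  if c = firstZero s then (if L = ((0, 0, 0, 0), (0, 0, 0, 0)) then 1 else 0)
  else if c = firstNonzero s then P.beta4 r s L
  else (if L ∈ splitVecs8 then P.beta4 r s (vee8 L) else 0)

/-- `β^{(r′)}_{T,c} = Σ_{u ∈ Split(s)} α_T^{(r′)}(u) · (β_{T[u,r′],c} ⊗ β_{T[s−u,r′],c})` for the level-4 node `T =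
G[s,r]` (concatenation product: positions 1–4 from `T[u,r′]`, 5–8 from `T[s−u,r′]`). [cite: DupontEtAl2026, §2.3
(complete split distributions of positive-shape nodes)] -/
def nodeBetaR (P : Point) (r : Fin 6) (s : Shape) (r' : Fin 6) (c : Fin 3) (L : Vec4 × Vec4) : ℝ :=
  ∑ u ∈ split4 s, P.alphaT r s r' u * (childBeta P r s r' u c L.1 * childBeta P r s r' (sub3 s u) c L.2)

/-- `β_{T,c} = Σ_{r′} A_T^{(r′)} β^{(r′)}_{T,c}` for the level-4 node `T = G[s,r]`. [cite: DupontEtAl2026, §2.3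
(complete split distributions of positive-shape nodes)] -/
def nodeBeta (P : Point) (r : Fin 6) (s : Shape) (c : Fin 3) (L : Vec4 × Vec4) : ℝ :=
  ∑ r', P.AT r s r' * nodeBetaR P r s r' c L

/-- `β_{G[s,r], c}` of ANY root child (leaf or level-4 node), as used by eqs. (3)–(5). [cite: DupontEtAl2026, §2.3]
-/
def rootChildBeta (P : Point) (r : Fin 6) (s : Shape) (c : Fin 3) (L : Vec4 × Vec4) : ℝ :=
  if IsPos s then nodeBeta P r s c L else leafBeta4 P r s c L

/-! ## The root's retained exponent `E_G` (eqs. (3)–(5) with `S₄` and length-8 split vectors) -/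
/-- Entropy of the `c`-marginal of a distribution on level-4 shapes (values `0..16`). [cite: DupontEtAl2026, §2.3]
-/
def Hmarg4 (D : Finset Shape) (ρ : Shape → ℝ) (c : Fin 3) : ℝ := Hb (range 17) (marg D ρ c)

/-- `η^{(r)}_{G,Y}` (eq. (3)): shapes with `s_Z = 0` contribute `α(s) H(β_{G[s,r],Y})`, the others are grouped by `j
= s_Y ∈ {0,…,16}`. [cite: DupontEtAl2026, §2.3 eq. (3)] -/
def rootEtaY (P : Point) (r : Fin 6) : ℝ :=
  let cy := role r 1
  let cz := role r 2
  let α := P.alpha r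
  (∑ s ∈ shapes4.filter (fun s => coord s cz = 0), α s * Hb splitVecs8 (rootChildBeta P r s cy)) +
  ∑ j ∈ range 17,
    (let G := shapes4.filter (fun s => coord s cy = j ∧ 0 < coord s cz)
     let W := ∑ s ∈ G, α s
     if W = 0 then 0
     else W * Hb splitVecs8 (fun L => (∑ s ∈ G, α s * rootChildBeta P r s cy L) / W))

/-- `η^{(r)}_{G,Z}` (eq. (4)): shapes with `s_X = 0` or `s_Y = 0` contribute `α(s) H(β_{G[s,r],Z})`, the others are
grouped by `k = s_Z`. [cite: DupontEtAl2026, §2.3 eq. (4)] -/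
def rootEtaZ (P : Point) (r : Fin 6) : ℝ :=
  let cx := role r 0
  let cy := role r 1
  let cz := role r 2
  let α := P.alpha r
  (∑ s ∈ shapes4.filter (fun s => coord s cx = 0 ∨ coord s cy = 0),
      α s * Hb splitVecs8 (rootChildBeta P r s cz)) +
  ∑ k ∈ range 17,
    (let G := shapes4.filter (fun s => 0 < coord s cx ∧ 0 < coord s cy ∧ coord s cz = k)
     let W := ∑ s ∈ G, α s
     if W = 0 then 0
     else W * Hb splitVecs8 (fun L => (∑ s ∈ G, α s * rootChildBeta P r s cz L) / W))

/-- `β̄^{(r)}_{G,c} = Σ_s α^{(r)}(s) β_{G[s,r],c}`. [cite: DupontEtAl2026, §2.3 eq. (5)] -/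
def rootBetaBar (P : Point) (r : Fin 6) (c : Fin 3) (L : Vec4 × Vec4) : ℝ :=
  ∑ s ∈ shapes4, P.alpha r s * rootChildBeta P r s c L

/-- The `X`-rôle term of eq. (5): `H((α^{(r)})_X) − P_{S₄}(α^{(r)})`. [cite: DupontEtAl2026, §2.3 eq. (5)] -/
def rootTermX (P : Point) (r : Fin 6) : ℝ :=
  Hmarg4 shapes4 (P.alpha r) (role r 0) - penalty shapes4 (P.alpha r)

/-- The `Y`-rôle term of eq. (5): `H(β̄_Y) − η_Y`. [cite: DupontEtAl2026, §2.3 eq. (5)] -/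
def rootTermY (P : Point) (r : Fin 6) : ℝ := Hb splitVecs8 (rootBetaBar P r (role r 1)) - rootEtaY P r

/-- The `Z`-rôle term of eq. (5): `H(β̄_Z) − η_Z`. [cite: DupontEtAl2026, §2.3 eq. (5)] -/
def rootTermZ (P : Point) (r : Fin 6) : ℝ := Hb splitVecs8 (rootBetaBar P r (role r 2)) - rootEtaZ P r

/-- `E_G = Σ_r A_G^{(r)} min(X, Y, Z rôle terms)`. [cite: DupontEtAl2026, §2.3 eq. (5)] -/
def EG (P : Point) : ℝ := ∑ r, P.A r * min (rootTermX P r) (min (rootTermY P r) (rootTermZ P r))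

/-! ## The level-4 positive nodes' retained exponents (eqs. (6)–(8)) and `E₄` -/
/-- `η^{(r′)}_{T,Y}` of the level-4 node `T = G[s,r]` (eq. (6)): the `u ∈ Split(s)` with `u_Z = 0` contribute `w(u)
H(β_{T[u,r′],Y})`, the others are grouped by `j = u_Y ∈ {0,…,8}`. [cite: DupontEtAl2026, §2.3 eq. (6)] -/
def posEtaY (P : Point) (r : Fin 6) (s : Shape) (r' : Fin 6) : ℝ :=
  let cy := role r' 1
  let cz := role r' 2
  (∑ u ∈ (split4 s).filter (fun u => coord u cz = 0),
      childW P r s r' u * Hb splitVecs4 (childBeta P r s r' u cy)) +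
  ∑ j ∈ range 9,
    (let G := (split4 s).filter (fun u => coord u cy = j ∧ 0 < coord u cz)
     let W := ∑ u ∈ G, childW P r s r' u
     if W = 0 then 0
     else W * Hb splitVecs4 (fun L => (∑ u ∈ G, childW P r s r' u * childBeta P r s r' u cy L) / W))

/-- `η^{(r′)}_{T,Z}` of the level-4 node `T = G[s,r]` (eq. (7)). [cite: DupontEtAl2026, §2.3 eq. (7)] -/
def posEtaZ (P : Point) (r : Fin 6) (s : Shape) (r' : Fin 6) : ℝ :=
  let cx := role r' 0
  let cy := role r' 1
  let cz := role r' 2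
  (∑ u ∈ (split4 s).filter (fun u => coord u cx = 0 ∨ coord u cy = 0),
      childW P r s r' u * Hb splitVecs4 (childBeta P r s r' u cz)) +
  ∑ k ∈ range 9,
    (let G := (split4 s).filter (fun u => 0 < coord u cx ∧ 0 < coord u cy ∧ coord u cz = k)
     let W := ∑ u ∈ G, childW P r s r' u
     if W = 0 then 0
     else W * Hb splitVecs4 (fun L => (∑ u ∈ G, childW P r s r' u * childBeta P r s r' u cz L) / W))

/-- The `X`-rôle factor of eq. (8) for the level-4 node `T = G[s,r]` in region `r′`: `H((α_T^{(r′)})_X) −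
P_{Split(s)}(α_T^{(r′)})` (marginal values `0..8`). [cite: DupontEtAl2026, §2.3 eq. (8)] -/
def posTermX (P : Point) (r : Fin 6) (s : Shape) (r' : Fin 6) : ℝ :=
  Hmarg3 (split4 s) (P.alphaT r s r') (role r' 0) - penalty (split4 s) (P.alphaT r s r')

/-- The `Y`-rôle factor of eq. (8): `H(β^{(r′)}_{T,Y}) − η^{(r′)}_{T,Y}`. [cite: DupontEtAl2026, §2.3 eq. (8)] -/
def posTermY (P : Point) (r : Fin 6) (s : Shape) (r' : Fin 6) : ℝ :=
  Hb splitVecs8 (nodeBetaR P r s r' (role r' 1)) - posEtaY P r s r'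

/-- The `Z`-rôle factor of eq. (8): `H(β^{(r′)}_{T,Z}) − η^{(r′)}_{T,Z}`. [cite: DupontEtAl2026, §2.3 eq. (8)] -/
def posTermZ (P : Point) (r : Fin 6) (s : Shape) (r' : Fin 6) : ℝ :=
  Hb splitVecs8 (nodeBetaR P r s r' (role r' 2)) - posEtaZ P r s r'

/-- The eq. (8) factor of the level-4 node landing on the ABSOLUTE coordinate `c` in region `r′`. [cite:
DupontEtAl2026, §2.3 eq. (8)] -/
def posTermAt (P : Point) (r : Fin 6) (s : Shape) (r' : Fin 6) (c : Fin 3) : ℝ :=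
  if role r' 0 = c then posTermX P r s r'
  else if role r' 1 = c then posTermY P r s r' else posTermZ P r s r'

/-- `Σ_T E^{(r′)}_{T,c} = Σ_T m_T A_T^{(r′)} ·` (factor on `c`) over the level-4 positive nodes. [cite:
DupontEtAl2026, §2.3 eq. (8) and §2.4 (E_ℓ, ℓ = 4)] -/
def E4coord (P : Point) (r' : Fin 6) (c : Fin 3) : ℝ :=
  ∑ r, ∑ s ∈ posShapes4, mass4 P r s * P.AT r s r' * posTermAt P r s r' c

/-- `E₄ = Σ_{r′} min_c Σ_T E^{(r′)}_{T,c}`. [cite: DupontEtAl2026, §2.4 (definition of E_ℓ, ℓ = 4)] -/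
def E4 (P : Point) : ℝ := ∑ r', min (E4coord P r' 0) (min (E4coord P r' 1) (E4coord P r' 2))

/-! ## The level-3 positive nodes' retained exponents (eq. (8) at level 3, via the view) and `E₃` -/
/-- `Σ_U E^{(r″)}_{U,c}` over ALL level-3 positive nodes `U = T[u,r′]`: `m_U A_U^{(r″)} ·` (eq. (8) factor of `U` on
`c`, the `ℓ* = 3` file's `posTermAt` on the view). [cite: DupontEtAl2026, §2.4 (E_ℓ, ℓ = 3)] -/
def E3coord (P : Point) (r'' : Fin 6) (c : Fin 3) : ℝ :=
  ∑ r, ∑ s ∈ posShapes4, ∑ r', ∑ u ∈ (split4 s).filter IsPos,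
    mass3 P r s r' u * P.AU r s r' u r'' * CombinationLoss3.posTermAt (P.view3 r s r') 0 u r'' c

/-- `E₃ = Σ_{r″} min_c Σ_U E^{(r″)}_{U,c}`. [cite: DupontEtAl2026, §2.4 (definition of E_ℓ, ℓ = 3)] -/
def E3 (P : Point) : ℝ := ∑ r'', min (E3coord P r'' 0) (min (E3coord P r'' 1) (E3coord P r'' 2))

/-! ## Level-2 exponents `E₂` (eq. (9)) and local matrix sizes (eq. (10)) over the leaves -/
/-- `Σ_{T ∈ T⁺₂} E_{T,c}` over the positive leaves `U[v,r″]`: `m · (1, 1, H(μ,μ,1−2μ))`, the `H` on the coordinate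
where `v` has the entry `2`. [cite: DupontEtAl2026, §2.3 eq. (9)] -/
def E2coord (P : Point) (c : Fin 3) : ℝ :=
  ∑ r, ∑ s ∈ posShapes4, ∑ r', ∑ u ∈ (split4 s).filter IsPos, ∑ r'', ∑ v ∈ (split3 u).filter IsPos,
    mass2 P r s r' u r'' v * (if coord v c = 2 then h3 (P.mu2 r s r' u r'' v) else 1)

/-- `E₂ = min_c Σ_T E_{T,c}`. [cite: DupontEtAl2026, §2.3 eq. (9)] -/
def E2 (P : Point) : ℝ := min (E2coord P 0) (min (E2coord P 1) (E2coord P 2))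

/-- `Σ_{leaves} M_{T,c}` (eq. (10)): positive level-2 leaves contribute `m (1−2μ) log₂ q` on the coordinates with
entry `1` and `m · 2μ log₂ q` on the one with entry `2`; a zero-shape leaf (at level 2, 3 or 4) contributes `m
(H(β_{W₁}) + Σ_L β_{W₁}(L) |{p : L_p = 1}| log₂ q)` on `W₀` and `0` elsewhere. [cite: DupontEtAl2026, §2.3 eq. (10)]
-/
def Mcoord (q : ℕ) (P : Point) (c : Fin 3) : ℝ :=
  (∑ r, ∑ s ∈ posShapes4, ∑ r', ∑ u ∈ (split4 s).filter IsPos, ∑ r'',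
    ((∑ v ∈ (split3 u).filter IsPos, mass2 P r s r' u r'' v *
        (if coord v c = 2 then 2 * P.mu2 r s r' u r'' v else 1 - 2 * P.mu2 r s r' u r'' v) *
          Real.logb 2 q) +
     (∑ v ∈ (split3 u).filter (fun v => ¬ IsPos v), if firstZero v = c then
        mass2 P r s r' u r'' v * (Hb splitVecs (P.beta2 r s r' u r'' v) +
          (∑ L ∈ splitVecs, P.beta2 r s r' u r'' v L * (ones L : ℝ)) * Real.logb 2 q) else 0))) +
  (∑ r, ∑ s ∈ posShapes4, ∑ r', ∑ u ∈ (split4 s).filter (fun u => ¬ IsPos u),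
    if firstZero u = c then
      mass3 P r s r' u * (Hb splitVecs4 (P.beta3 r s r' u) +
        (∑ L ∈ splitVecs4, P.beta3 r s r' u L * (ones4 L : ℝ)) * Real.logb 2 q) else 0) +
  (∑ r, ∑ s ∈ zeroShapes4, if firstZero s = c then
      mass4 P r s * (Hb splitVecs8 (P.beta4 r s) +
        (∑ L ∈ splitVecs8, P.beta4 r s L * (ones8 L : ℝ)) * Real.logb 2 q) else 0)

/-- `M_total = min_c Σ_{leaves} M_{T,c}`. [cite: DupontEtAl2026, §2.4] -/
def Mtotal (q : ℕ) (P : Point) : ℝ := min (Mcoord q P 0) (min (Mcoord q P 1) (Mcoord q P 2))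

/-! ## Program (11) at `ℓ* = 4` and Theorem 1 -/
/-- `E_total = E_G + E₂ + E₃ + E₄`. [cite: DupontEtAl2026, §2.4] -/
def Etotal (P : Point) : ℝ := EG P + E2 P + E3 P + E4 P

/-- Feasibility of `(P, Ω)` for program (11) at `(q, ℓ* = 4)`: `E_total + M_total · Ω ≥ 2^{ℓ*−1} log₂(q+2) = 8
log₂(q+2)`. [cite: DupontEtAl2026, §2.4 eq. (11)] -/
def Feasible (q : ℕ) (P : Point) (Ω : ℝ) : Prop :=
  8 * Real.logb 2 (q + 2) ≤ Etotal P + Mtotal q P * Ω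

/-- `S₄` is exactly the set of triples of naturals summing to `2⁴ = 16`. [cite: DupontEtAl2026, §2.1] -/
theorem mem_shapes4_iff (i j k : ℕ) : (i, j, k) ∈ shapes4 ↔ i + j + k = 16 := by
  simp only [shapes4, Finset.mem_image, Finset.mem_filter, Finset.mem_product, Finset.mem_range,
    Prod.exists, Prod.mk.injEq]
  exact ⟨fun ⟨a, b, ⟨⟨_, _⟩, hab⟩, ha, hb, hc⟩ => by omega,
    fun h => ⟨i, j, ⟨⟨by omega, by omega⟩, by omega⟩, rfl, rfl, by omega⟩⟩

/-- `S₄` has 153 shapes, 105 positive and 48 zero-shapes (the root has `6 · 153 = 918` children, of which `630` are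
level-4 positive nodes). [cite: DupontEtAl2026, §2.1] -/
theorem card_shapes4 : shapes4.card = 153 ∧ posShapes4.card = 105 ∧ zeroShapes4.card = 48 := by
  refine ⟨by decide +kernel, by decide +kernel, by decide +kernel⟩

/-- Example: `Split((14,1,1)) = {(8,0,0), (7,1,0), (7,0,1), (6,1,1)}`. [cite: DupontEtAl2026, §2.1] -/
theorem split4_14_1_1 : split4 (14, 1, 1) = {(6, 1, 1), (7, 0, 1), (7, 1, 0), (8, 0, 0)} := by
  decide +kernel

end CombinationLoss4

/-- **Theorem 1 of Dupont et al. 2026 (= Alman–Duan–Vassilevska Williams–Xu–Xu–Zhou 2025), case `ℓ* = 4`:** for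
every integer `q ≥ 1`, every parameter point in the stated domains that is feasible for program (11) at `ℓ* = 4`
with objective `Ω` certifies `ω ≤ Ω` (over `ℂ`).  Named fact (statement only; the proof is the combination-loss
laser method on `CW_q^{⊗8}`, Alman et al. 2025 §4–§6, not formalised; see the file docstring for the honest
framing). [cite: DupontEtAl2026, §2.4 Thm. 1 and eq. (11); AlmanDuanVassilevskaWilliamsXuXuZhou2025, §7] -/
def combinationLoss4_theorem1 : Prop :=
  ∀ (q : ℕ), 1 ≤ q → ∀ (P : CombinationLoss4.Point) (Ω : ℝ),
    P.Valid → CombinationLoss4.Feasible q P Ω → omega ℂ ≤ Ω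

end Literature.Computability.AlgebraicComplexity
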